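import Literature.Claims.NS.Kyritsis2026
import Summits.NavierStokesRegularity.NavierStokesRegularity.Theorems.SoloSalvageKyritsis2017
import HarnessLib

/-!
# Solo salvage for claim C03d `Kyritsis2026` (cell `ns-claims`, D-0090): the velocity half of
# Step 3 («Fefferman implicit hypothesis») kernel-discharged

Claim skeleton: `Literature/Claims/NS/Kyritsis2026.lean` (typist `ns-claims-typist-3`; ADJUDICATED #3:
locator `Step8C` (3.4.0) p. 93, class vacuous/circular, by the skeleton's own iff). This file (seat
`ns-claims-salvage-p3`) records the TRUE part of `Step_3` (pp. 91, 96–97: «a blowup in finite time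
… will imply a blowup of the velocities in finite time») that the tree proves outright:

* `velocity_unbounded_of_not_hasSobolevExtensionPast` — for `ν > 0`, a class solution on `[0,T)`
  (classical, all `L²` Sobolev norms bounded on compact sub-intervals) that does NOT continue in the
  class past `T` has UNBOUNDED velocity on `[0,T) × ℝ³` (the `L^∞` continuation criterion,
  contrapositive of `Kyritsis2017Salvage.step3_holds` / the tree's Bae–Choe endpoint criterion;
  Fefferman's Clay text p. 2; Serrin-class continuation).
* What is NOT proved here (the remaining content of `Step_3`): the localisation of the unboundedness
  to a FINITE point `S` («no singularity at spatial infinity», Lemma 3.2 p. 91 after Galdi /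
  Caffarelli–Kohn–Nirenberg partial regularity plus decay) — tabled «classical + cite» in
  `claims/Kyritsis2026/SALVAGE.md`.

Solo lane (`Theorems/SoloSalvage<Slug>.lean`, no item).

WHAT THIS IS NOT: not a claim about NS regularity or blow-up; not a claim about any author beyond the
typed locator.
-/

noncomputable section

-- The summit-side namespace repeats the summit name by design (D-0017 layout); tree precedent
-- `SoloSalvageRamm2024.lean`.
set_option linter.dupNamespace false

open MeasureTheory Set Filter
open scoped ENNReal Topology ContDiff

namespace Summit.NavierStokesRegularity.NavierStokesRegularity.Theorems.Kyritsis2026Salvage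

open Literature.Analysis.FluidPDE Literature.Claims.NS.Kyritsis2021 Literature.Claims.NS.Kyritsis2026
open Summit.NavierStokesRegularity.NavierStokesRegularity.Theorems.Kyritsis2017Salvage

/-- **Bounded velocity ⇒ continuation in the class** (`ν > 0`; the `L^∞` criterion without the
compact-support hypothesis of `Kyritsis2017.Step_3`): by the tree's two-velocity-components criterion
at the `L^∞_t L^∞_x` endpoint. -/
theorem hasSobolevExtensionPast_of_velocity_bounded {ν T : ℝ} (hν : 0 < ν) (hT : 0 < T)
    {u : ℝ → EuclideanSpace ℝ (Fin 3) → EuclideanSpace ℝ (Fin 3)}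
    {p : ℝ → EuclideanSpace ℝ (Fin 3) → ℝ} (hsol : IsLocalClassSolution ν T u p) {M : ℝ}
    (hM : ∀ t ∈ Ico 0 T, ∀ x, ‖u t x‖ ≤ M) : HasSobolevExtensionPast ν u T := by
  have hcont : ∀ t ∈ Ico 0 T, Continuous (u t) := fun t ht =>
    (hsol.1.contDiff_velocity ht).continuous
  exact baeChoe_two_velocity_components_criterion_top_of_le hν hT hsol.1 hsol.2 (α := ⊤) le_top 0
    fun j _ => memLqLp_top_top_component hcont hM j

/-- **The velocity half of `Step_3` («Fefferman implicit hypothesis», pp. 96–97), kernel form:** for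
`ν > 0`, a class solution on `[0,T)` admitting no continuation in the class past `T` has unbounded
velocity on `[0,T) × ℝ³` — «a blowup in finite time … will imply a blowup of the velocities». The
existence of a FINITE blow-up point `S` (the other half of `Step_3`, via Lemma 3.2 p. 91) is not
derived here. -/
theorem velocity_unbounded_of_not_hasSobolevExtensionPast {ν T : ℝ} (hν : 0 < ν) (hT : 0 < T)
    {u : ℝ → EuclideanSpace ℝ (Fin 3) → EuclideanSpace ℝ (Fin 3)}
    {p : ℝ → EuclideanSpace ℝ (Fin 3) → ℝ} (hsol : IsLocalClassSolution ν T u p)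
    (hmax : ¬ HasSobolevExtensionPast ν u T) :
    ∀ M : ℝ, ∃ t ∈ Ico 0 T, ∃ x : EuclideanSpace ℝ (Fin 3), M < ‖u t x‖ := by
  intro M
  by_contra h
  push Not at h
  exact hmax (hasSobolevExtensionPast_of_velocity_bounded hν hT hsol (M := M)
    fun t ht x => h t ht x)

end Summit.NavierStokesRegularity.NavierStokesRegularity.Theorems.Kyritsis2026Salvage
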